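import Mathlib
import Literature.Analysis.FluidPDE.Tao2016AveragedNS.BoundedEternalSolutions
import Summits.NavierStokesRegularity.NavierStokesRegularity.Theorems.TaoLadderRungTwoBreakNoSurvivingEternalViscBddOneWakeDyadicDSSFrontOvershoot

/-!
# Crux `TaoLadderRungTwoBreak.NoSurvivingEternalViscBddOne` (stmt-NavierStokesRegularity-20419) / ⟨20205⟩ `NoSurvivingDSSOne`, DYADIC
# MEMBER: the OVERSHOOT CEILING `sup V_n ≤ 2Λ² v_n/(Λ² − κ√κ)` and a UNIFORM CONVEYOR GAP — every admissible single-profile DSS wave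
# of the dyadic member has `(Λ² − κ√κ)² ≤ 4Λ²(Λ² − κ²)`, hence `dssMu ε₀ T ≤ 1 − (1 − Λ^{-1/2})²/4`

MODEL lattice ODEs only (the non-negative Katz–Pavlović / Desnianskii–Novikov chain in Tao's critical variables and the tree's
single-profile `IsDSSWave ε₀ dyadicTable π T Φ`); nothing in this file is a statement about the Navier–Stokes equations, and no
stub, crux, rung or summit is proved by it (`--supports stmt-NavierStokesRegularity-20419`).  DEF-FREE; closes the loop opened by
`…WakeDyadicDSSOvershootFloor` (FLOOR `sup V_n ≥ v_n(Λ²−κ√κ)/(2(Λ²−κ²))`):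

* `energy_le_lifetimeFlux` — at every time `t < 0` the shell energy `Λ^{-2n}V_n(t)²` is at most the lifetime flux `∫_{(−∞,0)}Π_{n-1}`
  (shells are born at rest, the drain is non-negative);
* **`dss_overshoot_ceiling`** — hence, with `…DSSOvershootFloor.flux_le_sup_mul_feed` / `feed_le_terminal`, for a DSS solution:
  `V_n(t) ≤ 2Λ² v_n/(Λ² − κ√κ)` for every `t < 0` — an ABSOLUTE overshoot ceiling (no action constant; compare the tree's
  `noOvershoot` factor `e^{M/Λ}`), of size `≍ 1/log Λ` as the base tends to one;
* **`dss_conveyor_gap`** — FLOOR ≤ CEILING on a lit shell gives `(Λ² − κ√κ)² ≤ 4Λ²(Λ² − κ²)`: an admissible DSS front of the dyadic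
  member cannot be a nearly perfect conveyor — its contraction ratio obeys `Λ² − κ² ≥ (Λ² − κ√κ)²/(4Λ²) > Λ²(1 − Λ^{-1/2})²/4`;
* **`dssWave_conveyor_gap`**, **`dssWave_dssMu_le`** — BY NAME for the tree's admissible single-profile DSS waves of `dyadicTable`
  with a lit shell: `(Λ² − e^{T}√e^{T})² ≤ 4Λ²(Λ² − e^{2T})` and the UNIFORM sub-unitarity gap
  `dssMu ε₀ T ≤ 1 − (1 − (bigLam ε₀)^{-1/2})²/4` (`≈ 1 − (25/64)ε₀²`; the tree's gaps `dssMu_lt_one` /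
  `…UnitaryGapClosed` depend on the wave's action).  The (S₁) window is `dssMu ∈ [(1+ε₀)⁻¹, 1)`: this removes only its top sliver —
  the content of (ρ0)|dyadic on the DSS stratum is the rest of the window.

HONEST LABEL: elementary consequences of the hand's identity files; W1-dyadic, (ρ0), ⟨20419⟩, ⟨20205⟩ and every NS statement remain
OPEN; rung 0.
-/

-- the summit and its single sub-problem share the name (CONVENTIONS §1)
set_option linter.dupNamespace false

namespace Summit.NavierStokesRegularity.NavierStokesRegularity.Theorems.NoSurvivingEternalViscBddOne.DSSConveyorGap

open Filter Topology Set MeasureTheory Finset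
open Literature.Analysis.FluidPDE.TaoCascade
open Summit.NavierStokesRegularity.NavierStokesRegularity.Theorems.NoSurvivingEternalViscBddOne
open Summit.NavierStokesRegularity.NavierStokesRegularity.Theorems.NoSurvivingEternalViscBddOne.WakeCriterion
  (dyadic_crit_hasDerivAt dyadic_crit_tendsto dyadic_classical_hyp_nonneg)

variable {ε₀ κ : ℝ} {V : ℤ → ℝ → ℝ} {v : ℤ → ℝ} {P : ℤ → ℝ → ℝ}

/-! ## The shell energy never exceeds the lifetime flux into the shell -/

/-- **`Λ^{-2n}V_n(t)² ≤ ∫_{(−∞,0)} Π_{n-1}`** for every `t < 0`: a shell born at rest holds at most the energy that has flowed in,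
and the drain only removes energy.  [cite: Tao2016AveragedNS, §1.2, §4 Lemma 4.1 (4.8)–(4.10), §6.4; elementary] -/
theorem energy_le_lifetimeFlux (hε : 0 < ε₀)
    (hV : ∀ (n : ℤ) (t : ℝ), t < 0 →
      HasDerivAt (V n) (bigLam ε₀ * V (n - 1) t ^ 2 - (bigLam ε₀)⁻¹ * (V n t * V (n + 1) t)) t)
    (hpos : ∀ (n : ℤ) (t : ℝ), t < 0 → 0 ≤ V n t)
    (hP : ∀ k t, P k t = 2 * (((bigLam ε₀ ^ k)⁻¹) ^ 2 * (bigLam ε₀)⁻¹) * (V k t ^ 2 * V (k + 1) t))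
    (hpast : ∀ k : ℤ, Tendsto (V k) atBot (𝓝 0))
    (hPint : ∀ k : ℤ, IntegrableOn (P k) (Iic 0))
    (n : ℤ) {t : ℝ} (ht : t < 0) :
    ((bigLam ε₀ ^ n)⁻¹) ^ 2 * V n t ^ 2 ≤ ∫ s in Iio 0, P (n - 1) s := by
  have hΛ : 0 < bigLam ε₀ := bigLam_pos (by linarith)
  -- pointwise non-negativity of the fluxes
  have hPnn : ∀ (k : ℤ) (s : ℝ), s < 0 → 0 ≤ P k s := by
    intro k s hs
    rw [hP k s]
    have := hpos k s hs; have := hpos (k + 1) s hs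
    positivity
  set e : ℤ → ℝ → ℝ := fun k s => ((bigLam ε₀ ^ k)⁻¹) ^ 2 * V k s ^ 2 with hedef
  have he : ∀ k s, e k s = ((bigLam ε₀ ^ k)⁻¹) ^ 2 * V k s ^ 2 := fun k s => rfl
  -- window identity with one shell: e_n(t) − e_n(a) = ∫_a^t Π_{n-1} − ∫_a^t Π_n ≤ ∫_a^t Π_{n-1}
  have hwin : ∀ a : ℝ, a ≤ t → e n t - e n a ≤ ∫ s in a..t, P (n - 1) s := by
    intro a hat
    have h := EnergyFluxIdentity.blockEnergy_window hε hV he hP (n - 1) 1 hat ht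
    simp only [Finset.sum_range_one, Nat.cast_zero, add_zero, sub_add_cancel, Nat.cast_one] at h
    have hnn : 0 ≤ ∫ s in a..t, P n s :=
      intervalIntegral.integral_nonneg hat fun s hs => hPnn n s (lt_of_le_of_lt hs.2 ht)
    linarith
  -- `∫_a^t Π_{n-1} ≤ ∫_{(−∞,0)} Π_{n-1}` (non-negative integrand, `[a,t] ⊂ (−∞,0)`)
  have hmono : ∀ a : ℝ, a ≤ t → ∫ s in a..t, P (n - 1) s ≤ ∫ s in Iio 0, P (n - 1) s := by
    intro a hat
    rw [intervalIntegral.integral_of_le hat]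
    refine setIntegral_mono_set ((hPint (n - 1)).mono_set Iio_subset_Iic_self) ?_ ?_
    · exact ae_restrict_of_forall_mem measurableSet_Iio fun s hs => hPnn _ s hs
    · exact (Ioc_subset_Iic_self.trans (Iic_subset_Iio.2 ht)).eventuallyLE
  -- let `a → −∞`: `e_n(a) → 0`
  have hlim : Tendsto (fun a : ℝ => e n t - e n a) atBot (𝓝 (e n t - 0)) := by
    refine tendsto_const_nhds.sub ?_
    have h : Tendsto (fun a : ℝ => ((bigLam ε₀ ^ n)⁻¹) ^ 2 * V n a ^ 2) atBot
        (𝓝 (((bigLam ε₀ ^ n)⁻¹) ^ 2 * (0 : ℝ) ^ 2)) := ((hpast n).pow 2).const_mul _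
    rw [zero_pow two_ne_zero, mul_zero] at h
    exact h
  have hev : ∀ᶠ a in atBot, e n t - e n a ≤ ∫ s in Iio 0, P (n - 1) s := by
    filter_upwards [eventually_le_atBot t] with a ha
    exact (hwin a ha).trans (hmono a ha)
  have := le_of_tendsto hlim hev
  simpa [he] using this

/-! ## The overshoot ceiling of a DSS front -/

/-- **OVERSHOOT CEILING.**  For a non-negative period-one DSS solution (`V_{k+1}(t) = κV_k(κt)`, `0 < κ < Λ`) born at rest with
lifetime-integrable feeds, drains and fluxes: `V_n(t) ≤ 2Λ² v_n/(Λ² − κ√κ)` for every `t < 0` — an absolute bound on the overshoot of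
every shell over its stranded value (no action constant).
[cite: Tao2016AveragedNS, §1.2, §4 Lemma 4.1 (4.8)–(4.10), §6.4; elementary] -/
theorem dss_overshoot_ceiling (hε : 0 < ε₀) (hκ : 0 < κ) (hκΛ : κ < bigLam ε₀)
    (hV : ∀ (n : ℤ) (t : ℝ), t < 0 →
      HasDerivAt (V n) (bigLam ε₀ * V (n - 1) t ^ 2 - (bigLam ε₀)⁻¹ * (V n t * V (n + 1) t)) t)
    (hpos : ∀ (n : ℤ) (t : ℝ), t < 0 → 0 ≤ V n t)
    (hdss : ∀ (n : ℤ) (t : ℝ), t < 0 → V (n + 1) t = κ * V n (κ * t))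
    (hP : ∀ k t, P k t = 2 * (((bigLam ε₀ ^ k)⁻¹) ^ 2 * (bigLam ε₀)⁻¹) * (V k t ^ 2 * V (k + 1) t))
    (hv : ∀ n : ℤ, Tendsto (V n) (𝓝[<] 0) (𝓝 (v n)))
    (hpast : ∀ k : ℤ, Tendsto (V k) atBot (𝓝 0))
    (hsq : ∀ k : ℤ, IntegrableOn (fun t => V k t ^ 2) (Iic 0))
    (hdr : ∀ k : ℤ, IntegrableOn (fun t => V k t * V (k + 1) t) (Iic 0))
    (hPint : ∀ k : ℤ, IntegrableOn (P k) (Iic 0))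
    (n : ℤ) {t : ℝ} (ht : t < 0) :
    V n t ≤ 2 * bigLam ε₀ ^ 2 * v n / (bigLam ε₀ ^ 2 - κ * Real.sqrt κ) := by
  have hΛ : 0 < bigLam ε₀ := bigLam_pos (by linarith)
  have hΛne : bigLam ε₀ ≠ 0 := hΛ.ne'
  have hvn : 0 ≤ v n := ge_of_tendsto (hv n) (eventually_nhdsWithin_of_forall fun t ht => hpos n t ht)
  have hsqrt : Real.sqrt κ < bigLam ε₀ := by
    have hΛ1 : 1 < bigLam ε₀ := Real.one_lt_rpow (by linarith) (by norm_num)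
    rw [Real.sqrt_lt' hΛ]; nlinarith
  have hgap : 0 < bigLam ε₀ ^ 2 - κ * Real.sqrt κ := by
    have : κ * Real.sqrt κ < bigLam ε₀ * bigLam ε₀ := mul_lt_mul'' hκΛ hsqrt hκ.le (Real.sqrt_nonneg κ)
    nlinarith
  -- a bound `S` for shell `n` on `t < 0` (it exists: the shells are bounded); we use the supremum
  obtain ⟨K, hK⟩ : ∃ K : ℝ, ∀ s : ℝ, s < 0 → V n s ≤ K := by
    -- boundedness from the type of hypotheses: use the energy bound with the lifetime flux
    refine ⟨Real.sqrt ((∫ s in Iio 0, P (n - 1) s) / ((bigLam ε₀ ^ n)⁻¹) ^ 2), fun s hs => ?_⟩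
    have h := energy_le_lifetimeFlux hε hV hpos hP hpast hPint n hs
    have hw : 0 < ((bigLam ε₀ ^ n)⁻¹) ^ 2 := by positivity
    have h2 : V n s ^ 2 ≤ (∫ s in Iio 0, P (n - 1) s) / ((bigLam ε₀ ^ n)⁻¹) ^ 2 := by
      rw [le_div_iff₀ hw]; linarith
    calc V n s ≤ Real.sqrt (V n s ^ 2) := by rw [Real.sqrt_sq (hpos n s hs)]
      _ ≤ _ := Real.sqrt_le_sqrt h2
  -- the least upper bound `S₀ = sup_{s<0} V_n(s)`
  set S₀ : ℝ := sSup ((fun s => V n s) '' Iio 0) with hS₀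
  have hne : ((fun s => V n s) '' Iio (0 : ℝ)).Nonempty := ⟨V n (-1), -1, by norm_num, rfl⟩
  have hbdd : BddAbove ((fun s => V n s) '' Iio (0 : ℝ)) := ⟨K, by rintro _ ⟨s, hs, rfl⟩; exact hK s hs⟩
  have hS : ∀ s : ℝ, s < 0 → V n s ≤ S₀ := fun s hs => le_csSup hbdd ⟨s, hs, rfl⟩
  have hS0 : 0 ≤ S₀ := (hpos n (-1) (by norm_num)).trans (hS (-1) (by norm_num))
  -- energy ≤ flux ≤ 2Λ^{-2(n-1)}Λ⁻¹ S₀ I ≤ 2Λ^{-2n}Λ S₀ · v_n Λ/(Λ² − κ√κ)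
  set I := ∫ s in Iio 0, V (n - 1) s ^ 2 with hI
  have hI0 : 0 ≤ I := setIntegral_nonneg measurableSet_Iio fun s _ => sq_nonneg _
  have hfeed : (bigLam ε₀ - κ * Real.sqrt κ / bigLam ε₀) * I ≤ v n :=
    DSSOvershootFloor.feed_le_terminal hκ hV hdss hv hpast hsq hdr hε n
  have hflux : ∫ s in Iio 0, P (n - 1) s ≤ 2 * (((bigLam ε₀ ^ (n - 1))⁻¹) ^ 2 * (bigLam ε₀)⁻¹) * S₀ * I :=
    DSSOvershootFloor.flux_le_sup_mul_feed hε hP hsq hPint n hS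
  have hwt : 2 * (((bigLam ε₀ ^ (n - 1))⁻¹) ^ 2 * (bigLam ε₀)⁻¹) = 2 * ((bigLam ε₀ ^ n)⁻¹) ^ 2 * bigLam ε₀ := by
    rw [zpow_sub_one₀ hΛne n]
    have : bigLam ε₀ ^ n ≠ 0 := zpow_ne_zero n hΛne
    field_simp
  rw [hwt] at hflux
  have hfac : 0 < bigLam ε₀ - κ * Real.sqrt κ / bigLam ε₀ := by
    rw [sub_pos, div_lt_iff₀ hΛ]; nlinarith
  have hIle : I ≤ v n / (bigLam ε₀ - κ * Real.sqrt κ / bigLam ε₀) := by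
    rw [le_div_iff₀ hfac]; linarith
  -- for every `s < 0`: `w V_n(s)² ≤ 2 w Λ S₀ I`
  have hall : ∀ s : ℝ, s < 0 → V n s ^ 2 ≤ 2 * bigLam ε₀ * S₀ * (v n / (bigLam ε₀ - κ * Real.sqrt κ / bigLam ε₀)) := by
    intro s hs
    have h := energy_le_lifetimeFlux hε hV hpos hP hpast hPint n hs
    have hw : 0 < ((bigLam ε₀ ^ n)⁻¹) ^ 2 := by positivity
    have h3 : ((bigLam ε₀ ^ n)⁻¹) ^ 2 * V n s ^ 2 ≤ ((bigLam ε₀ ^ n)⁻¹) ^ 2 * (2 * bigLam ε₀ * S₀ * I) := by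
      calc ((bigLam ε₀ ^ n)⁻¹) ^ 2 * V n s ^ 2 ≤ ∫ s in Iio 0, P (n - 1) s := h
        _ ≤ 2 * ((bigLam ε₀ ^ n)⁻¹) ^ 2 * bigLam ε₀ * S₀ * I := hflux
        _ = ((bigLam ε₀ ^ n)⁻¹) ^ 2 * (2 * bigLam ε₀ * S₀ * I) := by ring
    have h4 : V n s ^ 2 ≤ 2 * bigLam ε₀ * S₀ * I := le_of_mul_le_mul_left h3 hw
    have h5 : 2 * bigLam ε₀ * S₀ * I ≤ 2 * bigLam ε₀ * S₀ * (v n / (bigLam ε₀ - κ * Real.sqrt κ / bigLam ε₀)) :=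
      mul_le_mul_of_nonneg_left hIle (by positivity)
    exact h4.trans h5
  -- the constant: `2ΛS₀ v/(Λ − κ√κ/Λ) = S₀ · c` with `c = 2Λ² v/(Λ² − κ√κ)`
  set c : ℝ := 2 * bigLam ε₀ ^ 2 * v n / (bigLam ε₀ ^ 2 - κ * Real.sqrt κ) with hc
  have hc0 : 0 ≤ c := by positivity
  have hcS : 2 * bigLam ε₀ * S₀ * (v n / (bigLam ε₀ - κ * Real.sqrt κ / bigLam ε₀)) = S₀ * c := by
    rw [hc]
    field_simp
  -- `S₀² ≤ S₀ c`, hence `S₀ ≤ c`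
  have hS₀sq : S₀ ^ 2 ≤ S₀ * c := by
    -- `V_n(s) ≤ √(S₀ c)` for all `s < 0`, so `S₀ ≤ √(S₀ c)`
    have hroot : ∀ s : ℝ, s < 0 → V n s ≤ Real.sqrt (S₀ * c) := by
      intro s hs
      have h := hall s hs
      rw [hcS] at h
      calc V n s ≤ Real.sqrt (V n s ^ 2) := by rw [Real.sqrt_sq (hpos n s hs)]
        _ ≤ Real.sqrt (S₀ * c) := Real.sqrt_le_sqrt h
    have hsup : S₀ ≤ Real.sqrt (S₀ * c) := csSup_le hne (by rintro _ ⟨s, hs, rfl⟩; exact hroot s hs)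
    have h2 := pow_le_pow_left₀ hS0 hsup 2
    rwa [Real.sq_sqrt (mul_nonneg hS0 hc0)] at h2
  have hS₀le : S₀ ≤ c := by
    rcases eq_or_lt_of_le hS0 with h0 | hpos0
    · rw [← h0]; exact hc0
    · exact le_of_mul_le_mul_left (by nlinarith [hS₀sq]) hpos0
  exact (hS t ht).trans hS₀le

/-- **UNIFORM CONVEYOR GAP.**  FLOOR ≤ CEILING on a lit shell (`v_n > 0`): every non-negative period-one DSS solution as above obeys
`(Λ² − κ√κ)² ≤ 4Λ²(Λ² − κ²)`; equivalently `Λ² − κ² ≥ (Λ² − κ√κ)²/(4Λ²)` — no admissible DSS front of the dyadic member is a nearly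
perfect conveyor, uniformly (the bound involves `Λ` and `κ` only).
[cite: Tao2016AveragedNS, §1.2, §4 Lemma 4.1 (4.8)–(4.10), §6.4; elementary] -/
theorem dss_conveyor_gap (hε : 0 < ε₀) (hκ : 0 < κ) (hκΛ : κ < bigLam ε₀)
    (hV : ∀ (n : ℤ) (t : ℝ), t < 0 →
      HasDerivAt (V n) (bigLam ε₀ * V (n - 1) t ^ 2 - (bigLam ε₀)⁻¹ * (V n t * V (n + 1) t)) t)
    (hpos : ∀ (n : ℤ) (t : ℝ), t < 0 → 0 ≤ V n t)
    (hdss : ∀ (n : ℤ) (t : ℝ), t < 0 → V (n + 1) t = κ * V n (κ * t))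
    (hP : ∀ k t, P k t = 2 * (((bigLam ε₀ ^ k)⁻¹) ^ 2 * (bigLam ε₀)⁻¹) * (V k t ^ 2 * V (k + 1) t))
    (hv : ∀ n : ℤ, Tendsto (V n) (𝓝[<] 0) (𝓝 (v n)))
    (hpast : ∀ k : ℤ, Tendsto (V k) atBot (𝓝 0))
    (hsq : ∀ k : ℤ, IntegrableOn (fun t => V k t ^ 2) (Iic 0))
    (hdr : ∀ k : ℤ, IntegrableOn (fun t => V k t * V (k + 1) t) (Iic 0))
    (hPint : ∀ k : ℤ, IntegrableOn (P k) (Iic 0))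
    (n : ℤ) (hvn : 0 < v n) :
    (bigLam ε₀ ^ 2 - κ * Real.sqrt κ) ^ 2 ≤ 4 * bigLam ε₀ ^ 2 * (bigLam ε₀ ^ 2 - κ ^ 2) := by
  have hΛ : 0 < bigLam ε₀ := bigLam_pos (by linarith)
  have hκ2 : κ ^ 2 < bigLam ε₀ ^ 2 := pow_lt_pow_left₀ hκΛ hκ.le two_ne_zero
  have hsqrt : Real.sqrt κ < bigLam ε₀ := by
    have hΛ1 : 1 < bigLam ε₀ := Real.one_lt_rpow (by linarith) (by norm_num)
    rw [Real.sqrt_lt' hΛ]; nlinarith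
  have hgap : 0 < bigLam ε₀ ^ 2 - κ * Real.sqrt κ := by
    have : κ * Real.sqrt κ < bigLam ε₀ * bigLam ε₀ := mul_lt_mul'' hκΛ hsqrt hκ.le (Real.sqrt_nonneg κ)
    nlinarith
  -- ceiling at each time, then floor with `S = ceiling`
  have hceil : ∀ t : ℝ, t < 0 → V n t ≤ 2 * bigLam ε₀ ^ 2 * v n / (bigLam ε₀ ^ 2 - κ * Real.sqrt κ) :=
    fun t ht => dss_overshoot_ceiling hε hκ hκΛ hV hpos hdss hP hv hpast hsq hdr hPint n ht
  have hfloor := DSSOvershootFloor.dss_overshoot_floor hε hκ hκΛ hV hpos hdss hP hv hpast hsq hdr hPint n hceil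
  -- `v · (Λ²−κ√κ)/(2(Λ²−κ²)) ≤ 2Λ² v/(Λ²−κ√κ)`; divide by `v > 0`
  have h1 : (bigLam ε₀ ^ 2 - κ * Real.sqrt κ) / (2 * (bigLam ε₀ ^ 2 - κ ^ 2))
      ≤ 2 * bigLam ε₀ ^ 2 / (bigLam ε₀ ^ 2 - κ * Real.sqrt κ) := by
    have h := hfloor
    rw [show 2 * bigLam ε₀ ^ 2 * v n / (bigLam ε₀ ^ 2 - κ * Real.sqrt κ)
        = v n * (2 * bigLam ε₀ ^ 2 / (bigLam ε₀ ^ 2 - κ * Real.sqrt κ)) by ring] at h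
    exact le_of_mul_le_mul_left h hvn
  rw [div_le_div_iff₀ (by linarith) hgap] at h1
  nlinarith [h1]

/-! ## By name: the tree's single-profile DSS waves of the dyadic member -/

section DSS

variable {perm : Equiv.Perm (Fin 1)} {T : ℝ} {Φ : Fin 1 → ℝ → Em 4} {r₀ : Fin 1}

/-- **UNIFORM CONVEYOR GAP FOR ADMISSIBLE SINGLE-PROFILE DSS WAVES OF THE DYADIC MEMBER.**  If `Φ` carries an admissible single-profile
DSS wave of `dyadicTable` with delay `T`, sub-unitary (`dssMu ε₀ T < 1`), whose eternal solution `dssEmbed π T Φ r₀` has a lit shell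
(terminal value `(r_n)₀ > 0`), then with `κ = e^{T}`: `(Λ² − κ√κ)² ≤ 4Λ²(Λ² − κ²)`.
[cite: Tao2016AveragedNS, §1.2, §4 Lemma 4.1 (4.8)–(4.10), §6.4; elementary] -/
theorem dssWave_conveyor_gap (hε : 0 < ε₀) (hΦ : IsDSSWave ε₀ dyadicTable perm T Φ) (hμ : dssMu ε₀ T < 1)
    {r : ℤ → Em 4} (hr : ∀ k : ℤ, Tendsto (fun σ : ℝ => Real.exp σ • dssEmbed perm T Φ r₀ k σ) atTop (𝓝 (r k)))
    {n : ℤ} (hn : 0 < r n 0) :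
    (bigLam ε₀ ^ 2 - Real.exp T * Real.sqrt (Real.exp T)) ^ 2 ≤ 4 * bigLam ε₀ ^ 2 * (bigLam ε₀ ^ 2 - Real.exp T ^ 2) := by
  have hW : IsEternal ε₀ dyadicTable (dssEmbed perm T Φ r₀) := hΦ.isEternal_dssEmbed r₀
  obtain ⟨hpos, -⟩ := dyadic_classical_hyp_nonneg hε hW
  exact dss_conveyor_gap
    (V := fun (k : ℤ) (s : ℝ) => (-s)⁻¹ * (dssEmbed perm T Φ r₀ k (-Real.log (-s))) 0)
    (v := fun k => r k 0)
    (P := fun (k : ℤ) (s : ℝ) => 2 * (((bigLam ε₀ ^ k)⁻¹) ^ 2 * (bigLam ε₀)⁻¹) *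
      (((-s)⁻¹ * (dssEmbed perm T Φ r₀ k (-Real.log (-s))) 0) ^ 2 *
        ((-s)⁻¹ * (dssEmbed perm T Φ r₀ (k + 1) (-Real.log (-s))) 0)))
    hε (Real.exp_pos T) (DSSFrontOvershoot.exp_lt_bigLam_of_dssMu_lt_one hε hμ)
    (fun k t ht => dyadic_crit_hasDerivAt hW k ht) hpos (fun k t ht => DSSFrontOvershoot.crit_dss T Φ perm r₀ k ht)
    (fun k t => rfl) (fun k => dyadic_crit_tendsto hr k) (fun k => DSSFrontOvershoot.crit_tendsto_atBot hε hW k)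
    (fun k => DSSFrontOvershoot.crit_integrableOn_sq hε hW k) (fun k => DSSFrontOvershoot.crit_integrableOn_mul hε hW k)
    (fun k => DSSFrontOvershoot.crit_integrableOn_flux hε hW k) n hn

/-- Algebra of the gap: `(Λ² − κ√κ)² ≤ 4Λ²(Λ² − κ²)` with `0 < κ < Λ`, `1 < Λ` gives `κ²/Λ² ≤ 1 − (1 − Λ^{-1/2})²/4`. [folklore] -/
theorem ratio_le_of_gap {Λ κ : ℝ} (hΛ : 1 < Λ) (hκ : 0 < κ) (hκΛ : κ < Λ)
    (h : (Λ ^ 2 - κ * Real.sqrt κ) ^ 2 ≤ 4 * Λ ^ 2 * (Λ ^ 2 - κ ^ 2)) :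
    κ ^ 2 / Λ ^ 2 ≤ 1 - (1 - (Real.sqrt Λ)⁻¹) ^ 2 / 4 := by
  have hΛ0 : 0 < Λ := by linarith
  have hsΛ : 0 < Real.sqrt Λ := Real.sqrt_pos.2 hΛ0
  have hsΛ1 : 1 < Real.sqrt Λ := by
    rw [show (1 : ℝ) = Real.sqrt 1 from Real.sqrt_one.symm]
    exact Real.sqrt_lt_sqrt zero_le_one hΛ
  have hss : Real.sqrt Λ * Real.sqrt Λ = Λ := Real.mul_self_sqrt hΛ0.le
  -- `κ√κ < Λ√Λ`, so `Λ² − κ√κ > Λ² − Λ√Λ = Λ²(1 − Λ^{-1/2}) > 0`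
  have hsk : Real.sqrt κ < Real.sqrt Λ := Real.sqrt_lt_sqrt hκ.le hκΛ
  have hk32 : κ * Real.sqrt κ < Λ * Real.sqrt Λ := mul_lt_mul'' hκΛ hsk hκ.le (Real.sqrt_nonneg κ)
  have hA : Λ ^ 2 * (1 - (Real.sqrt Λ)⁻¹) = Λ ^ 2 - Λ * Real.sqrt Λ := by
    field_simp
    nlinarith [hss]
  have hApos : 0 < 1 - (Real.sqrt Λ)⁻¹ := by
    rw [sub_pos, inv_lt_one_iff₀]; exact Or.inr hsΛ1
  have hB : Λ ^ 2 * (1 - (Real.sqrt Λ)⁻¹) < Λ ^ 2 - κ * Real.sqrt κ := by rw [hA]; linarith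
  have hBpos : 0 < Λ ^ 2 * (1 - (Real.sqrt Λ)⁻¹) := by positivity
  have hsq : (Λ ^ 2 * (1 - (Real.sqrt Λ)⁻¹)) ^ 2 < (Λ ^ 2 - κ * Real.sqrt κ) ^ 2 :=
    pow_lt_pow_left₀ hB hBpos.le two_ne_zero
  -- combine with the gap
  have hΛ2 : 0 < Λ ^ 2 := by positivity
  rw [div_le_iff₀ hΛ2]
  have h4 : (Λ ^ 2 * (1 - (Real.sqrt Λ)⁻¹)) ^ 2 ≤ 4 * Λ ^ 2 * (Λ ^ 2 - κ ^ 2) := (le_of_lt hsq).trans h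
  have h5 : Λ ^ 2 * (1 - (Real.sqrt Λ)⁻¹) ^ 2 ≤ 4 * (Λ ^ 2 - κ ^ 2) := by
    have : (Λ ^ 2 * (1 - (Real.sqrt Λ)⁻¹)) ^ 2 = Λ ^ 2 * (Λ ^ 2 * (1 - (Real.sqrt Λ)⁻¹) ^ 2) := by ring
    rw [this] at h4
    have h4' := le_of_mul_le_mul_left (by linarith [h4] : Λ ^ 2 * (Λ ^ 2 * (1 - (Real.sqrt Λ)⁻¹) ^ 2)
      ≤ Λ ^ 2 * (4 * (Λ ^ 2 - κ ^ 2))) hΛ2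
    exact h4'
  nlinarith [h5]

/-- **UNIFORM SUB-UNITARITY GAP, BY NAME**: every admissible single-profile DSS wave of the dyadic member with `dssMu ε₀ T < 1` and a
lit shell has `dssMu ε₀ T ≤ 1 − (1 − (√Λ)⁻¹)²/4`, `Λ = (1+ε₀)^{5/2}` — a gap depending on `ε₀` only (`≈ (25/64)ε₀²`), at the top of the
(S₁) window `[(1+ε₀)⁻¹, 1)`.  [cite: Tao2016AveragedNS, §1.2, §4 (the viscous equation before Thm. 4.2), §6.4; elementary] -/
theorem dssWave_dssMu_le (hε : 0 < ε₀) (hΦ : IsDSSWave ε₀ dyadicTable perm T Φ) (hμ : dssMu ε₀ T < 1)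
    {r : ℤ → Em 4} (hr : ∀ k : ℤ, Tendsto (fun σ : ℝ => Real.exp σ • dssEmbed perm T Φ r₀ k σ) atTop (𝓝 (r k)))
    {n : ℤ} (hn : 0 < r n 0) :
    dssMu ε₀ T ≤ 1 - (1 - (Real.sqrt (bigLam ε₀))⁻¹) ^ 2 / 4 := by
  have hΛ1 : 1 < bigLam ε₀ := Real.one_lt_rpow (by linarith) (by norm_num)
  have hgap := dssWave_conveyor_gap hε hΦ hμ hr hn
  have h := ratio_le_of_gap hΛ1 (Real.exp_pos T) (DSSFrontOvershoot.exp_lt_bigLam_of_dssMu_lt_one hε hμ) hgap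
  have e : dssMu ε₀ T = Real.exp T ^ 2 / bigLam ε₀ ^ 2 := by
    unfold dssMu
    rw [bigLam_sq hε.le, ← Real.exp_nat_mul]; push_cast; ring_nf
  rw [e]
  exact h

end DSS

end Summit.NavierStokesRegularity.NavierStokesRegularity.Theorems.NoSurvivingEternalViscBddOne.DSSConveyorGap
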